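import Mathlib
import HarnessLib
import Summits.NavierStokesRegularity.NavierStokesRegularity.Theorems.LocalHelicityTubeDoorFrobeniusProfileRigidityExtremal

/-!
# Door S11 `LocalTubeDoorHelicity`, crux K2⁗ `FrobeniusProfileRigidity` — extremal elements of an invariant sub-class: FAR-PAST
# SATURATION and BLOW-DOWNS OF EXTREMALS ARE EXTREMAL (generic; part 1 of the extremal–recurrent normal form)

Cell ns-regularity-ideate, seat p6 (route-directed support for the door route `route-helicity`; lands `--supports` the K2⁗
item; no claim on the crux).  The K2 lead's H1 files for the POLOIDAL sub-class (ns-poloidal-K2-p1: `…PoloidalExtremalFarPast`,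
`…PoloidalExtremalBlowDown`) restated ONCE for an ABSTRACT sub-class predicate `P` preserved by spatial translations, parabolic
rescalings `nsRescale c` (`c > 0`), backward time shifts `u ↦ u(· − δ)` (`δ ≥ 0`), and closed under pointwise convergence of
fields and gradients on the open slab (continuing `…FrobeniusProfileRigidityExtremal.exists_extremal_of_subclass`).  «Extremal»
means: `C > 0`, `u ∈ 𝔓(C)`, `P u`, `‖u(−1,0)‖ = C`, `C` minimal among the Type-I constants of nontrivial `P`-elements (spelled out
in each statement).

* `farPast_saturation_of_subclass` — an extremal `P`-element nearly saturates its bound arbitrarily far in the past: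
  `∀ ε > 0, ∀ T < 0, ∃ t < T, ∃ x, (C − ε)/√(−t) < ‖u(t,x)‖` (else a backward time shift lowers the constant);
* `blowDown_extremal_of_subclass` — it has a blow-down `λⱼ u(λⱼ² t, xⱼ + λⱼ x) → W` on the slab with `(C, W)` again extremal.

Part 2 (`…FrobeniusProfileRigidityExtremalRecurrent`): Birkhoff recurrence, the self-recurrent extremal element, the reduction,
and the Frobenius instance.

SUPPORT EDGE (route-NavierStokesRegularity-LocalHelicityTubeDoor born; director-ns g6 #1 (5)): this file is re-pointed
`--supports stmt-NavierStokesRegularity-19975 --as helper` (nsreg-p6 g6 p482400: generic extremal far-past/blow-down normal form); it was parked on the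
CLOSED fallback anchor stmt-NavierStokesRegularity-20018 while the route was unborn.  Declarations unchanged.

WHAT THIS IS NOT: not a claim about Navier–Stokes regularity and not K2⁗ — a normal form (compactness + symmetry, no new mechanism)
for a door route's open profile crux (bears_on LADDER-NS N0, door S11).
-/

noncomputable section

-- the summit and its single sub-problem share the name (CONVENTIONS §1), as in every Theorems file
set_option linter.dupNamespace false

namespace Summit.NavierStokesRegularity.NavierStokesRegularity.Theorems.LocalHelicityTubeDoorFrobeniusProfileRigidityExtremalBlowDown

open MeasureTheory Set Function Filter Topology
open scoped RealInnerProductSpace InnerProductSpace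
open Literature.Analysis Literature.Analysis.FluidPDE
open Summit.NavierStokesRegularity.NavierStokesRegularity.Theorems
open Summit.NavierStokesRegularity.NavierStokesRegularity.Theorems.PoloidalWindowDoorPoloidalWindowRigidityPoloidalExtremal
open Summit.NavierStokesRegularity.NavierStokesRegularity.Theorems.PoloidalWindowDoorPoloidalWindowRigidityWindow
open Summit.NavierStokesRegularity.NavierStokesRegularity.Theorems.PoloidalWindowDoorPoloidalWindowRigidityFlat
open Summit.NavierStokesRegularity.NavierStokesRegularity.Theorems.LocalHelicityTubeDoorFrobeniusProfileRigidityExtremal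

variable {P : (ℝ → EuclideanSpace ℝ (Fin 3) → EuclideanSpace ℝ (Fin 3)) → Prop}

/-! ### Far-past saturation -/

/-- **Far-past saturation of an extremal element** (`P` preserved by backward time shifts): for every `ε > 0` and
`T < 0` there are `t < T` and `x` with `(C − ε)/√(−t) < ‖u(t,x)‖`. -/
theorem farPast_saturation_of_subclass
    (hPsh : ∀ (u : ℝ → EuclideanSpace ℝ (Fin 3) → EuclideanSpace ℝ (Fin 3)) (δ : ℝ), 0 ≤ δ → P u → P (fun t => u (t - δ)))
    {C : ℝ} {u : ℝ → EuclideanSpace ℝ (Fin 3) → EuclideanSpace ℝ (Fin 3)} (hext : (0 < C ∧ IsTypeIAncientMild C u ∧ P u ∧ ‖u (-1) 0‖ = C ∧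
      ∀ (C' : ℝ) (u' : ℝ → EuclideanSpace ℝ (Fin 3) → EuclideanSpace ℝ (Fin 3)), IsTypeIAncientMild C' u' → P u' →
        (∃ t < 0, ∃ x, u' t x ≠ 0) → C ≤ C'))
    {ε : ℝ} (hε : 0 < ε) {T : ℝ} (hT : T < 0) :
    ∃ t < T, ∃ x : EuclideanSpace ℝ (Fin 3), (C - ε) / Real.sqrt (-t) < ‖u t x‖ := by
  obtain ⟨hC, hA, hPu, hnorm, hmin⟩ := hext
  by_contra hcon
  push Not at hcon
  have hCε : 0 ≤ C - ε := by
    have h := hcon (T - 1) (by linarith) 0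
    have hs : 0 < Real.sqrt (-(T - 1)) := Real.sqrt_pos.2 (by linarith)
    by_contra hneg
    push Not at hneg
    have : (C - ε) / Real.sqrt (-(T - 1)) < 0 := div_neg_of_neg_of_pos hneg hs
    linarith [norm_nonneg (u (T - 1) 0)]
  set δ : ℝ := min (-T / 2) (1 / 2) with hδdef
  have hδpos : 0 < δ := lt_min (by linarith) (by norm_num)
  have hδT : δ < -T := lt_of_le_of_lt (min_le_left _ _) (by linarith)
  set q : ℝ := Real.sqrt (1 - δ / (-T)) with hqdef
  have hT0 : 0 < -T := by linarith
  have hq_arg : 0 < 1 - δ / (-T) := by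
    rw [sub_pos, div_lt_one hT0]; exact hδT
  have hq_arg1 : 1 - δ / (-T) < 1 := by
    have : 0 < δ / (-T) := div_pos hδpos hT0
    linarith
  have hq1 : q < 1 := by
    rw [hqdef, Real.sqrt_lt' one_pos, one_pow]
    exact hq_arg1
  set C' : ℝ := max (C - ε) (q * C) with hC'def
  have hC'lt : C' < C := max_lt (by linarith) (by nlinarith)
  have hshift : IsTypeIAncientMild C (fun t => u (t - δ)) := hA.comp_sub_right hδpos.le
  have hdecay : HasTypeITimeDecay C' (fun t => u (t - δ)) := by
    intro t ht x
    have hst : 0 < Real.sqrt (-t) := Real.sqrt_pos.2 (by linarith)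
    show ‖u (t - δ) x‖ ≤ C' / Real.sqrt (-t)
    by_cases hfar : t - δ < T
    · refine (hcon (t - δ) hfar x).trans ?_
      have h1 : (C - ε) / Real.sqrt (-(t - δ)) ≤ (C - ε) / Real.sqrt (-t) :=
        div_le_div_of_nonneg_left hCε hst (Real.sqrt_le_sqrt (by linarith))
      exact h1.trans (div_le_div_of_nonneg_right (le_max_left _ _) hst.le)
    · push Not at hfar
      have hs0 : t - δ < 0 := by linarith
      refine (hA.norm_le hs0 x).trans ?_
      have hsd : 0 < Real.sqrt (-(t - δ)) := Real.sqrt_pos.2 (by linarith)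
      have hmt : -t ≤ -T - δ := by linarith
      have hkey : Real.sqrt (-t) ≤ q * Real.sqrt (-(t - δ)) := by
        rw [hqdef, ← Real.sqrt_mul hq_arg.le]
        refine Real.sqrt_le_sqrt ?_
        rw [show -(t - δ) = δ + -t by ring]
        have e : (1 - δ / -T) * (δ + -t) = δ + -t - δ / -T * δ - δ / -T * -t := by ring
        rw [e]
        have h2 : δ / -T * -t ≤ δ / -T * (-T - δ) :=
          mul_le_mul_of_nonneg_left hmt (div_pos hδpos hT0).le
        have h3 : δ / -T * (-T - δ) = δ - δ / -T * δ := by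
          rw [mul_sub, div_mul_cancel₀ _ hT0.ne']
        nlinarith [h2, h3]
      have hle : C / Real.sqrt (-(t - δ)) ≤ q * C / Real.sqrt (-t) := by
        rw [div_le_div_iff₀ hsd hst]
        calc C * Real.sqrt (-t) ≤ C * (q * Real.sqrt (-(t - δ))) :=
              mul_le_mul_of_nonneg_left hkey hC.le
          _ = q * C * Real.sqrt (-(t - δ)) := by ring
      exact hle.trans (div_le_div_of_nonneg_right (le_max_right _ _) hst.le)
  have hshift' : IsTypeIAncientMild C' (fun t => u (t - δ)) :=
    ⟨hshift.1, hshift.2.1, hshift.2.2.1, hdecay⟩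
  have hne : ∃ t < (0 : ℝ), ∃ x, (fun t => u (t - δ)) t x ≠ 0 := by
    have hδ1 : δ < 1 := lt_of_le_of_lt (min_le_right _ _) (by norm_num)
    refine ⟨-1 + δ, by linarith, 0, ?_⟩
    show u (-1 + δ - δ) 0 ≠ 0
    rw [show (-1 : ℝ) + δ - δ = -1 by ring, ← norm_pos_iff, hnorm]
    exact hC
  have hle : C ≤ C' := hmin C' (fun t => u (t - δ)) hshift' (hPsh u δ hδpos.le hPu) hne
  linarith

/-! ### Blow-downs of extremals are extremal -/

/-- **Blow-downs of an extremal `P`-element are extremal `P`-elements**: there are scales `λ_j → ∞`, centres `x_j` and a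
field `W` with `λ_j u(λ_j² t, x_j + λ_j x) → W(t,x)` on the slab and `(C, W)` extremal in the sub-class `P`. -/
theorem blowDown_extremal_of_subclass
    (hPtr : ∀ (u : ℝ → EuclideanSpace ℝ (Fin 3) → EuclideanSpace ℝ (Fin 3)) (x₀ : EuclideanSpace ℝ (Fin 3)),
      P u → P (fun t x => u t (x₀ + x)))
    (hPsc : ∀ (u : ℝ → EuclideanSpace ℝ (Fin 3) → EuclideanSpace ℝ (Fin 3)) (c : ℝ), 0 < c → P u → P (nsRescale c u))
    (hPsh : ∀ (u : ℝ → EuclideanSpace ℝ (Fin 3) → EuclideanSpace ℝ (Fin 3)) (δ : ℝ), 0 ≤ δ → P u → P (fun t => u (t - δ)))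
    (hPlim : ∀ (V : ℕ → ℝ → EuclideanSpace ℝ (Fin 3) → EuclideanSpace ℝ (Fin 3))
      (W : ℝ → EuclideanSpace ℝ (Fin 3) → EuclideanSpace ℝ (Fin 3)), (∀ k, P (V k)) →
      (∀ t < 0, ∀ x, Tendsto (fun k => V k t x) atTop (𝓝 (W t x))) →
      (∀ t < 0, ∀ x, Tendsto (fun k => fderiv ℝ (V k t) x) atTop (𝓝 (fderiv ℝ (W t) x))) → P W)
    {C : ℝ} {u : ℝ → EuclideanSpace ℝ (Fin 3) → EuclideanSpace ℝ (Fin 3)} (hext : (0 < C ∧ IsTypeIAncientMild C u ∧ P u ∧ ‖u (-1) 0‖ = C ∧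
      ∀ (C' : ℝ) (u' : ℝ → EuclideanSpace ℝ (Fin 3) → EuclideanSpace ℝ (Fin 3)), IsTypeIAncientMild C' u' → P u' →
        (∃ t < 0, ∃ x, u' t x ≠ 0) → C ≤ C')) :
    ∃ (lam : ℕ → ℝ) (xs : ℕ → EuclideanSpace ℝ (Fin 3)) (W : ℝ → EuclideanSpace ℝ (Fin 3) → EuclideanSpace ℝ (Fin 3)),
      (∀ j, 0 < lam j) ∧ Tendsto lam atTop atTop ∧
      (∀ t < (0 : ℝ), ∀ x, Tendsto (fun j => lam j • u (lam j ^ 2 * t) (xs j + lam j • x)) atTop (𝓝 (W t x))) ∧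
      (0 < C ∧ IsTypeIAncientMild C W ∧ P W ∧ ‖W (-1) 0‖ = C ∧
        ∀ (C' : ℝ) (u' : ℝ → EuclideanSpace ℝ (Fin 3) → EuclideanSpace ℝ (Fin 3)), IsTypeIAncientMild C' u' → P u' →
          (∃ t < 0, ∃ x, u' t x ≠ 0) → C ≤ C') := by
  have hC := hext.1
  have hA := hext.2.1
  have hPu := hext.2.2.1
  have hmin := hext.2.2.2.2
  have hsat : ∀ ε : ℝ, 0 < ε → ∀ T : ℝ, T < 0 → ∃ t < T, ∃ x : EuclideanSpace ℝ (Fin 3),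
      (C - ε) / Real.sqrt (-t) < ‖u t x‖ := fun ε hε T hT =>
    farPast_saturation_of_subclass hPsh hext hε hT
  have hpts : ∀ k : ℕ, ∃ t < -(((k : ℝ) + 1) ^ 2), ∃ x : EuclideanSpace ℝ (Fin 3),
      (C - 1 / ((k : ℝ) + 1)) / Real.sqrt (-t) < ‖u t x‖ := fun k =>
    hsat (1 / ((k : ℝ) + 1)) (by positivity) (-(((k : ℝ) + 1) ^ 2)) (neg_neg_of_pos (by positivity))
  choose tk htk xk hxk using hpts
  have htk0 : ∀ k, tk k < 0 := fun k => (htk k).trans (neg_neg_of_pos (by positivity))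
  set lam : ℕ → ℝ := fun k => Real.sqrt (-tk k) with hlam
  have hlam_pos : ∀ k, 0 < lam k := fun k => Real.sqrt_pos.2 (neg_pos.2 (htk0 k))
  have hlam_gt : ∀ k : ℕ, (k : ℝ) + 1 < lam k := fun k => by
    have h1 : ((k : ℝ) + 1) ^ 2 < -tk k := by linarith [htk k]
    calc (k : ℝ) + 1 = Real.sqrt (((k : ℝ) + 1) ^ 2) := (Real.sqrt_sq (by positivity)).symm
      _ < Real.sqrt (-tk k) := Real.sqrt_lt_sqrt (by positivity) h1
  have hlam_top : Tendsto lam atTop atTop := by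
    refine tendsto_atTop_mono (fun k => (hlam_gt k).le) ?_
    exact tendsto_atTop_add_const_right _ 1 tendsto_natCast_atTop_atTop
  set v : ℕ → ℝ → EuclideanSpace ℝ (Fin 3) → EuclideanSpace ℝ (Fin 3) := fun k =>
    nsRescale (lam k) (fun t x => u t (xk k + x)) with hv
  have hvA : ∀ k, IsTypeIAncientMild C (v k) := fun k =>
    isTypeIAncientMild_nsRescale (isTypeIAncientMild_translate hA (xk k)) (hlam_pos k)
  have hvP : ∀ k, P (v k) := fun k => hPsc _ _ (hlam_pos k) (hPtr _ (xk k) hPu)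
  have hv_apply : ∀ k t x, v k t x = lam k • u (lam k ^ 2 * t) (xk k + lam k • x) := fun k t x => by
    simp [hv, nsRescale_apply]
  have hv_hot : ∀ k : ℕ, C - 1 / ((k : ℝ) + 1) < ‖v k (-1) 0‖ := by
    intro k
    have e1 : lam k ^ 2 * (-1 : ℝ) = tk k := by
      rw [hlam]; simp only
      rw [Real.sq_sqrt (neg_pos.2 (htk0 k)).le]; ring
    rw [hv_apply, e1, smul_zero, add_zero, norm_smul, Real.norm_of_nonneg (hlam_pos k).le]
    have h := hxk k
    rw [div_lt_iff₀ (hlam_pos k)] at h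
    linarith [h]
  obtain ⟨φ, hφ, W, hW, hpt, hDpt, -, -⟩ := exists_tendsto_of_isTypeIAncientMild_seq C hvA
  have hWP : P W := hPlim (fun j => v (φ j)) W (fun j => hvP (φ j)) hpt hDpt
  have hnormW : ‖W (-1) 0‖ = C := by
    have hup : ‖W (-1) 0‖ ≤ C := by
      have h := hW.norm_le (show (-1 : ℝ) < 0 by norm_num) 0
      rwa [neg_neg, Real.sqrt_one, div_one] at h
    have hlim : Tendsto (fun j => ‖v (φ j) (-1) 0‖) atTop (𝓝 ‖W (-1) 0‖) :=
      (hpt (-1) (by norm_num) 0).norm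
    have hlow : C ≤ ‖W (-1) 0‖ := by
      have hCj : Tendsto (fun j : ℕ => C - 1 / (((φ j : ℕ) : ℝ) + 1)) atTop (𝓝 (C - 0)) := by
        refine tendsto_const_nhds.sub ?_
        have h1 : Tendsto (fun j : ℕ => ((φ j : ℕ) : ℝ) + 1) atTop atTop :=
          tendsto_atTop_add_const_right _ 1
            (tendsto_natCast_atTop_atTop.comp hφ.tendsto_atTop)
        have h2 := tendsto_inv_atTop_zero.comp h1
        simpa [Function.comp_def, one_div] using h2
      rw [sub_zero] at hCj
      exact le_of_tendsto_of_tendsto' hCj hlim fun j => (hv_hot (φ j)).le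
    exact le_antisymm hup hlow
  refine ⟨fun j => lam (φ j), fun j => xk (φ j), W, fun j => hlam_pos _, hlam_top.comp hφ.tendsto_atTop,
    fun t ht x => ?_, hC, hW, hWP, hnormW, hmin⟩
  simpa only [hv_apply] using hpt t ht x


end Summit.NavierStokesRegularity.NavierStokesRegularity.Theorems.LocalHelicityTubeDoorFrobeniusProfileRigidityExtremalBlowDown

end
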